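import Summits.QuantumAdvantage.QuantumAdvantage.Theses.WhiteBoxWalk
import Literature.Computability.Cryptography.IndistinguishabilityObfuscatorSubexp
import Literature.Computability.Cryptography.PuncturablePRF
import Literature.Computability.Complexity.RandomizedProofs
import Summits.QuantumAdvantage.QuantumAdvantage.Theorems.WbwObfuscatedGluedTrees.Negative.KeyedIndistinguishability
import Summits.QuantumAdvantage.QuantumAdvantage.Theorems.WbwObfuscatedGluedTrees.Negative.TypedTraps

/-!
# Line `knowledge-of-walk-split` — skeleton for crux `WbwObfuscatedGluedTrees` (stmt-QuantumAdvantage-2340, route WhiteBoxWalk)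

crux-plan round 1 (planner-cruxplan-stmt-QuantumAdvantage-2340-knowledge-of-walk-sp-0, 2026-08-16), from idea card
`Cruxes/WbwObfuscatedGluedTrees/Ideas/knowledge-of-walk-split.md` (ideator 2; triage r1: 3 × pass, with the
mandatory sharpening of TRIAGE-r1-3: "never quantify KWA over the obfuscator").

## Status of the crux and what this skeleton concludes

The crux is INFORMAL: item stmt-QuantumAdvantage-2340 has no signature and the route file
`Theses/WhiteBoxWalk.lean` has no `def WbwObfuscatedGluedTrees` (the generator `obfuscatedGluedTreesGen`
is an open definition request).  Every seat so far (rattack `CruxTemplate`, the standing disprover's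
`Disproof.lean` §0, the three ideators) works against the TYPED STAND-IN `CruxShape obfGen` (copied verbatim in
§0 below): clause (C) of `WbwThesis` for the generator `obfGen O P f c`, for every sub-exponentially secure iO
`O`, every `(2^{κ^ε},2^{-κ^ε})`-secure puncturable PRF `P`, every injective one-way `f`, `c·ε > 1`.

This line's checked target is the closed, generator-generic statement `KnowledgeTransfer` (§4):

  for every line datum `𝓛` (key schedule, two key-indexed circuit families `C₀ ≡ C₁`, entrance/answer
  names, walk model) admissible for the sub-exp iO `O`:
  `Coherent → KnowledgeOfWalk 𝓛.M 𝓛.gen₀ → WordHard 𝓛.M 𝓛.gen₀ ans → ClauseC (𝓛.gen O) ans`,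

where `𝓛.gen₀ = genClear C₁` is the O-FREE reference generator (intended instance: `C₁ k̃ = pad_S(O₀(N_k; r₀))`,
the canonical neighbour circuit obfuscated ONCE by ONE fixed obfuscator `O₀` whose coins `r₀` are part of the
key `k̃ = (k, r₀)`) and `𝓛.gen O = genObf O C₀` is the crux-shaped generator (`C₀ k̃ = pad_S(N_k)` obfuscated by
the universally quantified `O`).  `theorem WbwObfuscatedGluedTrees_of` composes the three registered stubs
into `KnowledgeTransfer` BY NAME; `cruxShape_of_knowledgeTransfer` (§5, proved) shows how `CruxShape obfGen`
follows once the definition lands: `obfGen` factors through line data + the two generator-specific obligations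
`KnowledgeOfWalk` (KWA₀, conjecture-grade: a knowledge axiom) and `WordHard` (WordHard₀, crux-grade: white-box
PATH-finding hardness, advantage-neutral) for the reference generator.  Those two are the route-level
RE-TYPING the card and all three triagers ask for; they cannot be closed `Prop`s (hence not stubs) before
`obfuscatedGluedTreesGen` exists, and quantified over all data they would be false — so they are antecedents
of the target, named, not hidden.  `ledger skeleton check … --crux-decl <this namespace>.KnowledgeTransfer`.

## The three stubs (all generator-generic, believed TRUE, provable now; composed linearly)

* `stub_split` (M) — the SPLIT: `Coherent → KnowledgeOfWalk → WordHard → ClauseC` for any walk model and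
  generator.  Union bound `Pr[ans ≤+ A] ≤ Pr[KWA-failure] + Pr[E's word ends at ans]`; the word finder
  `W := ⟨fun z r => E (boolPair z r), A.coinLen⟩` TRANSPORTS `A`'s coin budget (the extractor is
  deterministic poly-time on (input, A's coins), so no coin-length computation is needed), and `WordHard W`
  bounds the second term.
* `stub_obfuscationMonotone` (M) — ideator-3's OBFUSCATION IS MONOTONE, re-typed: clause (C) for the CLEAR
  key-indexed family `C` implies clause (C) for its `O`-obfuscations (the adversary re-obfuscates by itself;
  `O.IsEfficient`, `κ` unary-poly-time; `O`'s coin count is not computable in the tree's model — guess it,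
  polynomial loss, harmless for a negligible-success conclusion).
* `stub_bestPossibleStep` (L, HARDEST) — ideator-3's BEST-POSSIBLE STEP, re-typed: for key-indexed families
  `C₀ k ≡ C₁ k` (same arity/size/function, both in `ppolyCircuits (κ n)`), clause (C) for `genObf O … C₁`
  implies clause (C) for `genObf O … C₀` when `O` is sub-exp iO.  Tool LANDED in the tree:
  `Negative.KeyedIndistinguishability.keyed_family_subexp` (worst-case-key advice; the distinguisher is
  "run A on (1ⁿ, code, name ENT), test the prefix", advice `(n, nm k, ans k)`); first normalise `A` to a
  computable polynomial coin budget (coin-length guessing, poly loss — legitimate for SEARCH success, cf.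
  `PseudorandomFunctionsPneNPProofs` header), then `δ(κ n) = 2^{-(κ n)^ε} ≤ 2^{-n^{cε}}` is negligible.

MODEL REPAIRS w.r.t. the ideator sketches (recorded for the lead): (i) `genObf` feeds `O` the PREFIX of the
seed tail of length `O.coins κ C` and the coin discipline is the INEQUALITY `O.coins ≤ n − h n` (ideator-3's
equality for both families is unsatisfiable: `encodeCircuit` lengths depend on the wiring, so two same-size
circuits have different codes and may have different coin demands); (ii) the KWA extractor is a deterministic
poly-time function of (input, coins) (Damgård/BCPR form; a probabilistic extractor is accommodated by
coin-length guessing at polynomial loss); (iii) `κ` unary-poly-time computable in `ObfuscationMonotone`.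

## Disproof.lean (cdisprove cycles 1–2) — what this skeleton honours

No `_false_without_` theorem exists for this crux (both cycles: "no `¬`-target; `not_cruxShape_imp`").
§5 `QuantumShadow.no_erasing_terminal`: honoured BY DESIGN — the classical-only, non-black-box-in-`A` step is
the antecedent `KnowledgeOfWalk` (extractor reads `A`'s coins); no stub ends in an answer-free world (every
stub keeps `ans` = `name(EXIT)` in the instance's functionality; `stub_bestPossibleStep` compares two
functionally EQUAL families).  §4 one-iO-to-all + quantifier-order obligation: `stub_bestPossibleStep` is its
positive form and its landed tool `Negative/KeyedIndistinguishability.lean` is imported here.  §0b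
`TypedTraps` (imported): `Coherent` forces `ans s` to be a valid non-entrance name of length `nameLen` on
EVERY seed, so the `ans = []` trap is excluded at the hypothesis.  §1/§1b/§1c/§1d (role order, depth leak,
altimeter, structured cycle) and §2 (malleable names): they make `WordHard` resp. `KnowledgeOfWalk` FALSE for
the corresponding mutant data — consistent with the split (the sanity lemmas `not_wordHard_of_detWord`,
`not_knowledgeOfWalk_of_unreachable` in §6 are the typed form of the card's falsifier (3)); none of the three
stubs is an instance a landed `Negative/` lemma refutes (they are reductions, not hardness claims).  §3
percolation: not engaged (nothing is un-named or planted).  TRIAGE-r1-3 gadget attack on `CruxPlus`: honoured —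
KWA is asserted for ONE O-free reference family `C₁`, never for `∀ O`.
-/

set_option linter.dupNamespace false

namespace Summit.QuantumAdvantage.QuantumAdvantage.Cruxes.WbwObfuscatedGluedTrees.KnowledgeOfWalkSplit

open Literature.Computability.Cryptography Literature.Computability.Complexity Filter Asymptotics

/-! ## §0 Clause (C) and the typed shape of the crux (verbatim, Disproof.lean §0) -/

/-- Clause (C) of `WbwThesis` for a fixed generator/answer pair `(gen, ans)` (verbatim conjunct of the route
decl `Summit.QuantumAdvantage.QuantumAdvantage.Theses.WhiteBoxWalk.WbwThesis`). -/
def ClauseC (gen ans : List Bool → List Bool) : Prop :=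
  ∀ A : RandAlg (List Bool) (List Bool), IsPPT A id →
    SuperpolynomialDecay atTop (fun n : ℕ => (n : ℝ)) (fun n : ℕ =>
      uniformAvg n fun s => A.pr id (boolPair (Computability.unaryEncodeNat n) (gen s)) {y | ans s <+: y})

/-- The abstraction is faithful: the route target is `∃ gen ans, FP ∧ length ∧ (Q) ∧ ClauseC gen ans`. -/
theorem wbwThesis_iff :
    Summit.QuantumAdvantage.QuantumAdvantage.Theses.WhiteBoxWalk.WbwThesis ↔
      ∃ (gen ans : List Bool → List Bool), PolyTimeComputable id id gen ∧
        (∃ p : Polynomial ℕ, ∀ s, (ans s).length = p.eval (gen s).length) ∧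
        (∃ F : QCircuitFamily cliffordT, F.IsOracleFree ∧ F.IsUniform ∧
          ∀ s, 2 / 3 ≤ F.kernelProb 0 (gen s) {y | ans s <+: y}) ∧ ClauseC gen ans :=
  Iff.rfl

/-- The type of the missing definition `obfuscatedGluedTreesGen` (verbatim, Disproof.lean §0). -/
abbrev GenType : Type :=
  CircuitObfuscator → PuncturablePRFScheme → (List Bool → List Bool) → ℕ →
    (List Bool → List Bool) × (List Bool → List Bool)

/-- The typed shape of the informal crux (verbatim, Disproof.lean §0 / rattack `CruxTemplate`). -/
def CruxShape (obfGen : GenType) : Prop :=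
  ∀ ε : ℝ, 0 < ε → ε < 1 → ∀ O : CircuitObfuscator, IsSubexpIO ε ppolyCircuits O →
    ∀ P : PuncturablePRFScheme,
      IsTDSecurePuncturablePRF P (fun κ => (2 : ℝ) ^ ((κ : ℝ) ^ ε))
        (fun κ => (2 : ℝ) ^ (-((κ : ℝ) ^ ε))) →
      ∀ f : List Bool → List Bool, IsOneWay f → Function.Injective f →
        ∀ c : ℕ, 1 < (c : ℝ) * ε → ClauseC (obfGen O P f c).1 (obfGen O P f c).2

/-! ## §1 Walk semantics, the knowledge-of-walk axiom, word hardness -/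

/-- Walk semantics of instance strings `x = ⟨code, name of ENTRANCE⟩`: the entrance name, the common length
of vertex names, and the neighbour LISTING computed by the code on a name (`none` = the invalid answer `⊥`;
the listing is in the canonical sorted order of `gluedTreesOracle`, Disproof §1 / typing obligation T4). -/
structure WalkModel where
  /-- name of the ENTRANCE carried by the instance -/
  entrance : List Bool → List Bool
  /-- the common length of vertex names of the instance -/
  nameLen : List Bool → ℕ
  /-- neighbour listing of the instance on a name (`none` on invalid names) -/
  nbrs : List Bool → List Bool → Option (List (List Bool))

namespace WalkModel

/-- Execute the walk-word `w` (read right to left; each letter = a position in the sorted neighbour list)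
from the ENTRANCE of instance `x`; `none` if the walk leaves the valid names. -/
def endpoint (M : WalkModel) (x : List Bool) : List ℕ → Option (List Bool)
  | [] => some (M.entrance x)
  | i :: w => (endpoint M x w).bind fun cur => (M.nbrs x cur).bind fun l => l[i]?

/-- `y` is a valid vertex name of instance `x`. -/
def IsValid (M : WalkModel) (x y : List Bool) : Prop := (M.nbrs x y).isSome = true

/-- The NAME PART of an output string `y` for instance `x`: its prefix of length `nameLen x`
(clause (C) asks for `ans s <+: y`; under `Coherent`, `ans s <+: y ↔ nameOf x y = ans s`). -/
def nameOf (M : WalkModel) (x y : List Bool) : List Bool := y.take (M.nameLen x)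

end WalkModel

/-- The adversary's input at level `n` and seed `s`: `⟨1ⁿ, gen s⟩` (as in clause (C)). -/
def inst (gen : List Bool → List Bool) (n : ℕ) (s : List Bool) : List Bool :=
  boolPair (Computability.unaryEncodeNat n) (gen s)

/-- **KWA — knowledge of walk (classical PPT, white-box; DETERMINISTIC extractor).**  For every PPT `A`
there is a deterministic polynomial-time extractor `E`, reading `A`'s input AND `A`'s coin string, such that
the event "the name part of `A`'s output is a valid vertex name other than the ENTRANCE, yet `E`'s word does
not end there" has probability (over `A`'s coins, exactly `A.coinLen` of them) decaying superpolynomially on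
average over the seed.  White-box analogue of ROOTEDNESS (Childs–Coudron–Gilani arXiv:2211.12447); the
extractor's access to the coins is the non-black-box ingredient Disproof §5 demands (AGGM24 arXiv:2405.15736
§1.4).  NEVER to be asserted for all obfuscators (TRIAGE-r1-3 gadget): it is an axiom about ONE reference
generator. -/
def KnowledgeOfWalk (M : WalkModel) (gen : List Bool → List Bool) : Prop :=
  ∀ A : RandAlg (List Bool) (List Bool), IsPPT A id →
    ∃ E : List Bool → List ℕ, PolyTimeComputable id encodingListNatBool.encode E ∧
      SuperpolynomialDecay atTop (fun n : ℕ => (n : ℝ)) (fun n : ℕ =>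
        uniformAvg n fun s => uniformProb (A.coinLen (inst gen n s).length)
          {r | M.IsValid (gen s) (M.nameOf (gen s) (A.run (inst gen n s) r)) ∧
               M.nameOf (gen s) (A.run (inst gen n s) r) ≠ M.entrance (gen s) ∧
               M.endpoint (gen s) (E (boolPair (inst gen n s) r)) ≠
                 some (M.nameOf (gen s) (A.run (inst gen n s) r))})

/-- **WordHard — white-box path-finding hardness (advantage-neutral).**  No PPT, given `⟨1ⁿ, gen s⟩`,
outputs a walk-word from the ENTRANCE whose endpoint is the answer `ans s` (= `name(EXIT)`), except with
probability decaying superpolynomially on average over the seed.  Weaker than clause (C) whenever the walk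
model is efficiently evaluable (evaluate the word); conjecturally true against QUANTUM machines too
(welded-tree path finding, open: CCG22 §4; Li arXiv:2307.12492 / Li–Zur arXiv:2311.07372 treat variants). -/
def WordHard (M : WalkModel) (gen ans : List Bool → List Bool) : Prop :=
  ∀ W : RandAlg (List Bool) (List ℕ), IsPPT W encodingListNatBool.encode →
    SuperpolynomialDecay atTop (fun n : ℕ => (n : ℝ)) (fun n : ℕ =>
      uniformAvg n fun s => W.pr id (inst gen n s) {w | M.endpoint (gen s) w = some (ans s)})

/-- The walk model is coherent with `(gen, ans)`: on EVERY seed the answer is a valid vertex name of the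
right length and is not the ENTRANCE (for the crux's generator: `ans s = name_k(EXIT)`; this is where the
`ans = []` trap of `Negative/TypedTraps.lean` is excluded). -/
def Coherent (M : WalkModel) (gen ans : List Bool → List Bool) : Prop :=
  ∀ s, (ans s).length = M.nameLen (gen s) ∧ M.IsValid (gen s) (ans s) ∧ ans s ≠ M.entrance (gen s)

/-! ## §2 Generator shapes: a key-indexed circuit family, obfuscated or in the clear -/

/-- The OBFUSCATED generator built from a key-indexed circuit family `C`: the seed `s ∈ {0,1}ⁿ` is split as
`k := s.take (h n)` (key material) and the tail `s.drop (h n)`, of which the PREFIX of length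
`O.coins (κ n) (C k)` is the obfuscator's coin string; the instance is `⟨code of O(κ n, C k; coins), nm k⟩`.
(Under the discipline `O.coins ≤ n − h n` the law of the code given `k` is exactly `O.obfCodePMF (κ n) (C k)`:
a uniform prefix of a uniform string is uniform.) -/
def genObf (O : CircuitObfuscator) (κ h : ℕ → ℕ) (m : List Bool → ℕ)
    (C : (k : List Bool) → Circuit (Fin (m k))) (nm : List Bool → List Bool) (s : List Bool) :
    List Bool :=
  boolPair
    (encodeSizedCircuit ⟨m (s.take (h s.length)),
      O.obf (κ s.length) (C (s.take (h s.length)))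
        ((s.drop (h s.length)).take (O.coins (κ s.length) (C (s.take (h s.length)))))⟩)
    (nm (s.take (h s.length)))

/-- The CLEAR generator: same keys, the circuit `C k` handed out as is (the seed tail is unused). -/
def genClear (h : ℕ → ℕ) (m : List Bool → ℕ) (C : (k : List Bool) → Circuit (Fin (m k)))
    (nm : List Bool → List Bool) (s : List Bool) : List Bool :=
  boolPair (encodeSizedCircuit ⟨m (s.take (h s.length)), C (s.take (h s.length))⟩)
    (nm (s.take (h s.length)))

/-- A key-indexed string (answer / name) read off the seed: `ans (s.take (h |s|))`. -/
def keyed (h : ℕ → ℕ) (ans : List Bool → List Bool) (s : List Bool) : List Bool :=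
  ans (s.take (h s.length))

/-! ## §3 The three stubs -/

/-- Statement of `stub_split`. -/
def SplitLemma : Prop :=
  ∀ (M : WalkModel) (gen ans : List Bool → List Bool),
    Coherent M gen ans → KnowledgeOfWalk M gen → WordHard M gen ans → ClauseC gen ans

/-- Statement of `stub_obfuscationMonotone`. -/
def ObfuscationMonotone : Prop :=
  ∀ (O : CircuitObfuscator), O.IsEfficient →
  ∀ (κ h : ℕ → ℕ) (m : List Bool → ℕ) (C : (k : List Bool) → Circuit (Fin (m k)))
    (nm ans : List Bool → List Bool),
    PolyTimeComputable Computability.unaryEncodeNat Computability.unaryEncodeNat κ →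
    (∃ p : Polynomial ℕ, ∀ n, κ n ≤ p.eval n) → (∀ n, h n ≤ n) →
    (∀ s : List Bool, O.coins (κ s.length) (C (s.take (h s.length))) ≤ s.length - h s.length) →
    ClauseC (genClear h m C nm) (keyed h ans) →
    ClauseC (genObf O κ h m C nm) (keyed h ans)

/-- Statement of `stub_bestPossibleStep`. -/
def BestPossibleStep : Prop :=
  ∀ (ε : ℝ) (O : CircuitObfuscator), 0 < ε → IsSubexpIO ε ppolyCircuits O →
  ∀ (κ h : ℕ → ℕ) (m : List Bool → ℕ) (C₀ C₁ : (k : List Bool) → Circuit (Fin (m k)))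
    (nm ans : List Bool → List Bool),
    (∃ c : ℝ, 0 < c ∧ ∀ᶠ n : ℕ in atTop, (n : ℝ) ^ c ≤ κ n) →
    (∃ p : Polynomial ℕ, ∀ n, κ n ≤ p.eval n) → (∀ n, h n ≤ n) →
    (∀ s : List Bool,
        (⟨m (s.take (h s.length)), C₀ (s.take (h s.length))⟩ : SizedCircuit) ∈
            ppolyCircuits (κ s.length) ∧
        (⟨m (s.take (h s.length)), C₁ (s.take (h s.length))⟩ : SizedCircuit) ∈
            ppolyCircuits (κ s.length) ∧
        (C₀ (s.take (h s.length))).size = (C₁ (s.take (h s.length))).size ∧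
        (∀ x, (C₀ (s.take (h s.length))).eval x = (C₁ (s.take (h s.length))).eval x) ∧
        O.coins (κ s.length) (C₀ (s.take (h s.length))) ≤ s.length - h s.length ∧
        O.coins (κ s.length) (C₁ (s.take (h s.length))) ≤ s.length - h s.length) →
    ClauseC (genObf O κ h m C₁ nm) (keyed h ans) →
    ClauseC (genObf O κ h m C₀ nm) (keyed h ans)

/-- **STUB 1 (M) — the split.**  For any walk model coherent with `(gen, ans)`: KWA and WordHard give
clause (C).  Proof route: fix a PPT `A`, take its extractor `E` (KWA); pointwise in the coin string `r`,
`ans s <+: A.run z r` implies (by `Coherent`: `|ans s| = nameLen`, valid, `≠ entrance`) that either the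
KWA-failure event holds at `r` or `M.endpoint (gen s) (E (boolPair z r)) = some (ans s)`; hence
`A.pr id z {y | ans s <+: y} ≤ uniformProb … {KWA fails} + W.pr id z {w | endpoint = ans s}` for the word
finder `W := ⟨fun z r => E (boolPair z r), A.coinLen⟩` (`RandAlg.pr` is a push-forward of the SAME uniform
coins: `uniformProb_eq_toOuterMeasure`, monotonicity and subadditivity of `PMF.toOuterMeasure`); `W` is PPT
because `E` is poly-time on `boolPair z r` — which IS the pair encoding `RandAlg.IsPolyTime` uses — and
`W.coinLen = A.coinLen` is polynomially bounded (coin budget TRANSPORTED, nothing to compute); average over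
`s`, then `SuperpolynomialDecay.add` and domination of a nonnegative sequence by a decaying one. -/
theorem stub_split :
    ∀ (M : WalkModel) (gen ans : List Bool → List Bool),
      Coherent M gen ans → KnowledgeOfWalk M gen → WordHard M gen ans → ClauseC gen ans := by
  sorry

/-- **STUB 2 (M) — obfuscation is monotone** (card `best-possible-transfer` lemma (a), re-typed).  If no
PPT finds the keyed answer given the CLEAR circuit `C k` and `nm k`, none finds it given an honest
obfuscation `O(κ n, C k; U)` with `nm k`.  Proof route: from a PPT `A` against `genObf` build `A'` against
`genClear`: on `⟨1ⁿ, ⟨code c, e⟩⟩` compute `κ n` (unary poly-time), GUESS the coin count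
`j ∈ [0, q(|input|)]` (`q` a polynomial bound of `O.coinLen`, from `O.IsEfficient`; the exact value
`O.coins (κ n) c` is not computable in the tree's model), re-obfuscate `c' := O.obf (κ n) c ρ[..j]` (poly-time:
`O.IsEfficient`) and run `A` on `⟨1ⁿ, ⟨code c', e⟩⟩` with fresh coins (normalise `A` to a computable
polynomial coin budget first — again by guessing, polynomial loss; legitimate because the conclusion is a
SEARCH-success bound).  On the correct guess the instance law is exactly that of `genObf` (uniform prefix of
the uniform seed tail, `O.coins ≤ n − h n`), so `succ(A') ≥ succ(A)/poly(n)`, and `ClauseC (genClear …)`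
makes `succ(A')` negligible. -/
theorem stub_obfuscationMonotone :
    ∀ (O : CircuitObfuscator), O.IsEfficient →
    ∀ (κ h : ℕ → ℕ) (m : List Bool → ℕ) (C : (k : List Bool) → Circuit (Fin (m k)))
      (nm ans : List Bool → List Bool),
      PolyTimeComputable Computability.unaryEncodeNat Computability.unaryEncodeNat κ →
      (∃ p : Polynomial ℕ, ∀ n, κ n ≤ p.eval n) → (∀ n, h n ≤ n) →
      (∀ s : List Bool, O.coins (κ s.length) (C (s.take (h s.length))) ≤ s.length - h s.length) →
      ClauseC (genClear h m C nm) (keyed h ans) →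
      ClauseC (genObf O κ h m C nm) (keyed h ans) := by
  sorry

/-- **STUB 3 (L, HARDEST) — the best-possible step** (card `best-possible-transfer` lemma (b) = the positive
form of Disproof §4's one-iO-to-all transfer).  For key-indexed families `C₀ k ≡ C₁ k` of the same arity,
size and function, both in `ppolyCircuits (κ n)`, and a sub-exp iO `O`: clause (C) for the obfuscations of
`C₁` implies clause (C) for the obfuscations of `C₀`.  Proof route: fix a PPT `A` against `genObf … C₀ …`,
normalised to a computable polynomial coin budget (guessing lemma, poly loss).  Distinguisher
`D(a, 1^κ, code) :=` "parse `a = (1ⁿ, e, t)`; run `A` on `boolPair 1ⁿ (boolPair code e)`; accept iff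
`t <+: output`" (PPT in `|code| ≥ κ ≥ n^c`), advice for key `k` at level `n`: `(1ⁿ, nm k, ans k)` of length
`poly(n) ≤ 2^{(κ n)^ε}` eventually.  `Negative.KeyedIndistinguishability.keyed_family_subexp` (imported) with
`keys κ₀ := {(n, k) | κ n = κ₀, k ∈ {0,1}^{h n}}` (finite: `n^c ≤ κ n`) gives, for all large `n` and ALL keys
at once, `|E_{O(C₀ k)} A.pr − E_{O(C₁ k)} A.pr| ≤ 2^{-(κ n)^ε}`; averaging over `k` (the seed law factors as
uniform key × uniform coin prefix, `O.coins ≤ n − h n`) bounds the difference of the two `uniformAvg`'s by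
`2^{-(κ n)^ε} ≤ 2^{-n^{cε}}`, superpolynomially small (`superpolynomialDecay_two_rpow_neg`-type estimate);
conclude with `SuperpolynomialDecay.add`. -/
theorem stub_bestPossibleStep :
    ∀ (ε : ℝ) (O : CircuitObfuscator), 0 < ε → IsSubexpIO ε ppolyCircuits O →
    ∀ (κ h : ℕ → ℕ) (m : List Bool → ℕ) (C₀ C₁ : (k : List Bool) → Circuit (Fin (m k)))
      (nm ans : List Bool → List Bool),
      (∃ c : ℝ, 0 < c ∧ ∀ᶠ n : ℕ in atTop, (n : ℝ) ^ c ≤ κ n) →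
      (∃ p : Polynomial ℕ, ∀ n, κ n ≤ p.eval n) → (∀ n, h n ≤ n) →
      (∀ s : List Bool,
          (⟨m (s.take (h s.length)), C₀ (s.take (h s.length))⟩ : SizedCircuit) ∈
              ppolyCircuits (κ s.length) ∧
          (⟨m (s.take (h s.length)), C₁ (s.take (h s.length))⟩ : SizedCircuit) ∈
              ppolyCircuits (κ s.length) ∧
          (C₀ (s.take (h s.length))).size = (C₁ (s.take (h s.length))).size ∧
          (∀ x, (C₀ (s.take (h s.length))).eval x = (C₁ (s.take (h s.length))).eval x) ∧
          O.coins (κ s.length) (C₀ (s.take (h s.length))) ≤ s.length - h s.length ∧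
          O.coins (κ s.length) (C₁ (s.take (h s.length))) ≤ s.length - h s.length) →
      ClauseC (genObf O κ h m C₁ nm) (keyed h ans) →
      ClauseC (genObf O κ h m C₀ nm) (keyed h ans) := by
  sorry

/-! ### Consistency: each named statement IS its registered stub (definitionally) -/

theorem splitLemma_holds : SplitLemma := stub_split
theorem obfuscationMonotone_holds : ObfuscationMonotone := stub_obfuscationMonotone
theorem bestPossibleStep_holds : BestPossibleStep := stub_bestPossibleStep

/-! ### Name-keyed aliases of the three statements (the hypotheses of the composition; the skeleton audit
admits a hypothesis only if its head constant is a registered obligation or is named like a declared stub) -/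
namespace Registered

/-- Alias of `SplitLemma` keyed by the registered stub name. -/
abbrev stub_split : Prop := SplitLemma
/-- Alias of `ObfuscationMonotone` keyed by the registered stub name. -/
abbrev stub_obfuscationMonotone : Prop := ObfuscationMonotone
/-- Alias of `BestPossibleStep` keyed by the registered stub name. -/
abbrev stub_bestPossibleStep : Prop := BestPossibleStep

end Registered

/-! ## §4 Line data and the line's target `KnowledgeTransfer` -/

/-- The data the (missing) generator definition must supply to this line: the security-parameter schedule
`κ`, the key length `h`, the arity `m k` and two key-indexed circuit families — `C₀ k` (intended: the
canonical neighbour circuit `N_k` of the named glued-trees graph, padded to a fixed size `S`) and `C₁ k`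
(intended: `pad_S (O₀.obf κ₀ N_k r₀)` for ONE fixed efficient functionality-preserving obfuscator `O₀`, its
coins `r₀` being part of the key) —, the entrance name `nm k`, the answer `ans k = name_k(EXIT)`, and the walk
model `M` (evaluate the code carried by the instance).  No hardness content. -/
structure LineData where
  /-- security parameter fed to the obfuscator at seed length `n` -/
  κ : ℕ → ℕ
  /-- number of seed bits used as key material -/
  h : ℕ → ℕ
  /-- arity of the neighbour circuit for key `k` -/
  m : List Bool → ℕ
  /-- the canonical (padded) neighbour circuit -/
  C₀ : (k : List Bool) → Circuit (Fin (m k))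
  /-- the O-free reference circuit (padded `O₀`-obfuscation of `C₀ k`), functionally equal, same size -/
  C₁ : (k : List Bool) → Circuit (Fin (m k))
  /-- name of the ENTRANCE for key `k` -/
  nm : List Bool → List Bool
  /-- the answer `name_k(EXIT)` for key `k` -/
  ans : List Bool → List Bool
  /-- walk semantics of the instances -/
  M : WalkModel

namespace LineData

/-- The O-free REFERENCE generator `⟨code of C₁ k, nm k⟩` — where KWA₀ and WordHard₀ are asserted. -/
def gen₀ (𝓛 : LineData) : List Bool → List Bool := genClear 𝓛.h 𝓛.m 𝓛.C₁ 𝓛.nm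

/-- The crux-shaped generator for the obfuscator `O`: `⟨code of O(κ n, C₀ k; coins), nm k⟩`. -/
def gen (𝓛 : LineData) (O : CircuitObfuscator) : List Bool → List Bool := genObf O 𝓛.κ 𝓛.h 𝓛.m 𝓛.C₀ 𝓛.nm

/-- The keyed answer `s ↦ ans (key of s)`. -/
abbrev answer (𝓛 : LineData) : List Bool → List Bool := keyed 𝓛.h 𝓛.ans

/-- DEFINITIONAL admissibility of the data for the obfuscator `O` (what the definition item discharges for
its schedule): `κ` unary-poly-time, `n^c ≤ κ n ≤ poly(n)`, `h n ≤ n`, and on every seed the two circuits lie in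
`ppolyCircuits (κ n)`, have equal size and equal function, and `O`'s coin demand fits in the seed tail. -/
def Admissible (𝓛 : LineData) (O : CircuitObfuscator) : Prop :=
  PolyTimeComputable Computability.unaryEncodeNat Computability.unaryEncodeNat 𝓛.κ ∧
  (∃ c : ℝ, 0 < c ∧ ∀ᶠ n : ℕ in atTop, (n : ℝ) ^ c ≤ 𝓛.κ n) ∧
  (∃ p : Polynomial ℕ, ∀ n, 𝓛.κ n ≤ p.eval n) ∧
  (∀ n, 𝓛.h n ≤ n) ∧
  (∀ s : List Bool,
      (⟨𝓛.m (s.take (𝓛.h s.length)), 𝓛.C₀ (s.take (𝓛.h s.length))⟩ : SizedCircuit) ∈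
          ppolyCircuits (𝓛.κ s.length) ∧
      (⟨𝓛.m (s.take (𝓛.h s.length)), 𝓛.C₁ (s.take (𝓛.h s.length))⟩ : SizedCircuit) ∈
          ppolyCircuits (𝓛.κ s.length) ∧
      (𝓛.C₀ (s.take (𝓛.h s.length))).size = (𝓛.C₁ (s.take (𝓛.h s.length))).size ∧
      (∀ x, (𝓛.C₀ (s.take (𝓛.h s.length))).eval x = (𝓛.C₁ (s.take (𝓛.h s.length))).eval x) ∧
      O.coins (𝓛.κ s.length) (𝓛.C₀ (s.take (𝓛.h s.length))) ≤ s.length - 𝓛.h s.length ∧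
      O.coins (𝓛.κ s.length) (𝓛.C₁ (s.take (𝓛.h s.length))) ≤ s.length - 𝓛.h s.length)

end LineData

/-- **The line's target (typed stand-in for the informal crux).**  For every line datum admissible for a
sub-exponentially secure iO `O`: if the walk model is coherent with the reference generator and the
reference generator satisfies KWA (classical extractability of walks) and WordHard (white-box path-finding
hardness), then clause (C) holds for the crux-shaped generator `𝓛.gen O`.  Closed and generator-generic; the
two generator-specific obligations are its named antecedents. -/
def KnowledgeTransfer : Prop :=
  ∀ (𝓛 : LineData) (ε : ℝ) (O : CircuitObfuscator), 0 < ε → IsSubexpIO ε ppolyCircuits O →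
    𝓛.Admissible O → Coherent 𝓛.M 𝓛.gen₀ 𝓛.answer →
    KnowledgeOfWalk 𝓛.M 𝓛.gen₀ → WordHard 𝓛.M 𝓛.gen₀ 𝓛.answer →
    ClauseC (𝓛.gen O) 𝓛.answer

/-- **Composition (kernel-checked, no `sorry`): the three registered stubs give the target BY NAME.**
`ClauseC 𝓛.gen₀` (split) → `ClauseC (genObf O … C₁ …)` (obfuscation is monotone) →
`ClauseC (genObf O … C₀ …) = ClauseC (𝓛.gen O)` (best-possible step). -/
theorem WbwObfuscatedGluedTrees_of (h₁ : Registered.stub_split)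
    (h₂ : Registered.stub_obfuscationMonotone) (h₃ : Registered.stub_bestPossibleStep) :
    KnowledgeTransfer := by
  intro 𝓛 ε O hε hO hadm hcoh hK hW
  obtain ⟨hκc, hκlo, hκhi, hh, hpair⟩ := hadm
  have c₁ : ClauseC 𝓛.gen₀ 𝓛.answer := h₁ 𝓛.M 𝓛.gen₀ 𝓛.answer hcoh hK hW
  have c₂ : ClauseC (genObf O 𝓛.κ 𝓛.h 𝓛.m 𝓛.C₁ 𝓛.nm) 𝓛.answer :=
    h₂ O hO.isEfficient 𝓛.κ 𝓛.h 𝓛.m 𝓛.C₁ 𝓛.nm 𝓛.ans hκc hκhi hh (fun s => (hpair s).2.2.2.2.2) c₁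
  exact h₃ ε O hε hO 𝓛.κ 𝓛.h 𝓛.m 𝓛.C₀ 𝓛.C₁ 𝓛.nm 𝓛.ans hκlo hκhi hh hpair c₂

/-- Wiring check: the registered stubs feed the composition as stated. -/
example : KnowledgeTransfer :=
  WbwObfuscatedGluedTrees_of stub_split stub_obfuscationMonotone stub_bestPossibleStep

/-! ## §5 From the target to the crux shape, once `obfuscatedGluedTreesGen` lands

The corollary isolates exactly what remains at ROUTE level after this line: (a) the definition factors
through line data (definitional), (b) admissibility and coherence (definitional), and (c) the two
generator-specific obligations for the REFERENCE generator — `KnowledgeOfWalk` (KWA₀: a knowledge axiom,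
conjecture item) and `WordHard` (WordHard₀: crux item, advantage-neutral) — under the crux's own hypotheses
on `(ε, P, f, c)`.  Nothing here is asserted; it is the re-typing request made precise. -/

/-- `CruxShape obfGen` from `KnowledgeTransfer` and the route-level obligations (proved; no `sorry`). -/
theorem cruxShape_of_knowledgeTransfer (hKT : KnowledgeTransfer) (obfGen : GenType)
    (𝓛 : PuncturablePRFScheme → (List Bool → List Bool) → ℕ → LineData)
    (hgen : ∀ O P f c, obfGen O P f c = ((𝓛 P f c).gen O, (𝓛 P f c).answer))
    (hadm : ∀ ε : ℝ, 0 < ε → ε < 1 → ∀ O : CircuitObfuscator, IsSubexpIO ε ppolyCircuits O →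
      ∀ P f c, (𝓛 P f c).Admissible O)
    (hcoh : ∀ P f c, Coherent (𝓛 P f c).M (𝓛 P f c).gen₀ (𝓛 P f c).answer)
    (hKW : ∀ ε : ℝ, 0 < ε → ε < 1 → ∀ P : PuncturablePRFScheme,
      IsTDSecurePuncturablePRF P (fun κ => (2 : ℝ) ^ ((κ : ℝ) ^ ε))
        (fun κ => (2 : ℝ) ^ (-((κ : ℝ) ^ ε))) →
      ∀ f : List Bool → List Bool, IsOneWay f → Function.Injective f → ∀ c : ℕ, 1 < (c : ℝ) * ε →
        KnowledgeOfWalk (𝓛 P f c).M (𝓛 P f c).gen₀ ∧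
          WordHard (𝓛 P f c).M (𝓛 P f c).gen₀ (𝓛 P f c).answer) :
    CruxShape obfGen := by
  intro ε hε hε1 O hO P hP f hf hinj c hc
  obtain ⟨hK, hW⟩ := hKW ε hε hε1 P hP f hf hinj c hc
  have h := hKT (𝓛 P f c) ε O hε hO (hadm ε hε hε1 O hO P f c) (hcoh P f c) hK hW
  rw [hgen]
  exact h

/-! ## §6 Calibration and typed sanity (not stubs)

* `ClauseCImpWordHard` — the converse direction requested by TRIAGE-r1-2 ("state `(C) → WordHard` next to
  the split, so the record shows KWA ⊢ ((C) ↔ WordHard)"): true whenever the walk model's `endpoint` is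
  poly-time evaluable from the instance; a SUPPORT statement, stated here, not load-bearing.
* `QuantumWordHard` — the line's standing bet (consistency condition "quantum KWA fails"): not used.
* Two proved sanity lemmas, the typed form of the card's falsifier (3): an explicit poly-time word that ends
  at the answer refutes `WordHard` (Disproof §1 role order, §1b/§1c altimeter, §1d structured cycle supply
  such words for the corresponding MUTANT data), and an adversary that always outputs a valid non-entrance
  name reachable by NO word refutes `KnowledgeOfWalk` (Disproof §2: the forged alias of the integrity-free
  naming).  They pin the definitions; they say nothing about the canonical data. -/

/-- `(C) → WordHard` given an efficient evaluator of walk-words (support statement; TRIAGE-r1-2). -/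
def ClauseCImpWordHard : Prop :=
  ∀ (M : WalkModel) (gen ans : List Bool → List Bool) (ev : List Bool → List Bool),
    PolyTimeComputable id id ev →
    (∀ n s w, ev (boolPair (inst gen n s) (encodingListNatBool.encode w)) =
        (M.endpoint (gen s) w).getD []) →
    Coherent M gen ans → ClauseC gen ans → WordHard M gen ans

/-- **QuantumWordHard** (the standing bet; advantage-neutrality of `WordHard`): no poly-time uniform
oracle-free Clifford+T family outputs (an encoding, via `decode`, of) an ENTRANCE→answer walk-word except with
superpolynomially decaying probability.  NOT a proof step. -/
def QuantumWordHard (M : WalkModel) (gen ans : List Bool → List Bool) (decode : List Bool → List ℕ) :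
    Prop :=
  ∀ F : QCircuitFamily cliffordT, F.IsOracleFree → F.IsUniform →
    SuperpolynomialDecay atTop (fun n : ℕ => (n : ℝ)) (fun n : ℕ =>
      uniformAvg n fun s => F.kernelProb 0 (gen s) {y | M.endpoint (gen s) (decode y) = some (ans s)})

/-- A sequence that is `1` frequently does not decay superpolynomially. -/
theorem not_superpolynomialDecay_of_frequently_eq_one {f : ℕ → ℝ}
    (h : ∃ᶠ n in atTop, f n = 1) : ¬ SuperpolynomialDecay atTop (fun n : ℕ => (n : ℝ)) f := by
  intro hdec
  have htend : Tendsto f atTop (nhds 0) := by simpa using hdec 0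
  have hev : ∀ᶠ n : ℕ in atTop, f n < 1 :=
    htend.eventually (gt_mem_nhds (by norm_num : (0 : ℝ) < 1))
  obtain ⟨n, hn, hlt⟩ := (h.and_eventually hev).exists
  rw [hn] at hlt
  exact lt_irrefl _ hlt

/-- **Sanity 1 (typed falsifier; Disproof §1/§1b/§1c/§1d mutants).**  If a deterministic poly-time word
function `w` ends at the answer on every seed of infinitely many lengths, `WordHard` fails. -/
theorem not_wordHard_of_detWord (M : WalkModel) (gen ans : List Bool → List Bool)
    (w : List Bool → List ℕ) (hw : PolyTimeComputable id encodingListNatBool.encode w)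
    (hhit : ∃ᶠ n in atTop, ∀ s : List Bool, s.length = n →
      M.endpoint (gen s) (w (inst gen n s)) = some (ans s)) :
    ¬ WordHard M gen ans := by
  classical
  intro hW
  have hPPT : IsPPT (RandAlg.ofDet w) encodingListNatBool.encode :=
    RandAlg.IsPolyTime.ofDet_holds hw
  refine not_superpolynomialDecay_of_frequently_eq_one ?_ (hW (RandAlg.ofDet w) hPPT)
  refine hhit.mono fun n hn => ?_
  have hpr : ∀ s : List Bool, s.length = n →
      (RandAlg.ofDet w).pr id (inst gen n s) {w' | M.endpoint (gen s) w' = some (ans s)} = 1 := by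
    intro s hs
    rw [RandAlg.pr_ofDet]
    simp [hn s hs]
  simp only [uniformAvg]
  rw [Finset.sum_congr rfl fun (x : List.Vector Bool n) _ => hpr x.toList (by simp)]
  simp [card_vector]

/-- `uniformProb` of an event containing every string of the sampled length is `1`. -/
theorem uniformProb_eq_one_of_forall {m : ℕ} {E : Set (List Bool)}
    (h : ∀ r : List Bool, r.length = m → r ∈ E) : uniformProb m E = 1 := by
  classical
  unfold uniformProb
  rw [Finset.filter_true_of_mem fun (r : List.Vector Bool m) _ => h r.toList (by simp)]
  simp [card_vector]

/-- **Sanity 2 (typed falsifier; Disproof §2 forged alias).**  If some PPT `A` outputs, on every seed of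
infinitely many lengths and every coin string, a valid non-entrance name that is the endpoint of NO walk-word,
then `KnowledgeOfWalk` fails (whatever the extractor). -/
theorem not_knowledgeOfWalk_of_unreachable (M : WalkModel) (gen : List Bool → List Bool)
    (A : RandAlg (List Bool) (List Bool)) (hA : IsPPT A id)
    (hforge : ∃ᶠ n in atTop, ∀ s : List Bool, s.length = n → ∀ r : List Bool,
      r.length = A.coinLen (inst gen n s).length →
        M.IsValid (gen s) (M.nameOf (gen s) (A.run (inst gen n s) r)) ∧
        M.nameOf (gen s) (A.run (inst gen n s) r) ≠ M.entrance (gen s) ∧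
        ∀ w : List ℕ, M.endpoint (gen s) w ≠ some (M.nameOf (gen s) (A.run (inst gen n s) r))) :
    ¬ KnowledgeOfWalk M gen := by
  classical
  intro hK
  obtain ⟨E, -, hdec⟩ := hK A hA
  refine not_superpolynomialDecay_of_frequently_eq_one ?_ hdec
  refine hforge.mono fun n hn => ?_
  have hone : ∀ s : List Bool, s.length = n →
      uniformProb (A.coinLen (inst gen n s).length)
        {r | M.IsValid (gen s) (M.nameOf (gen s) (A.run (inst gen n s) r)) ∧
             M.nameOf (gen s) (A.run (inst gen n s) r) ≠ M.entrance (gen s) ∧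
             M.endpoint (gen s) (E (boolPair (inst gen n s) r)) ≠
               some (M.nameOf (gen s) (A.run (inst gen n s) r))} = 1 := by
    intro s hs
    refine uniformProb_eq_one_of_forall fun r hr => ?_
    obtain ⟨hv, hne, hall⟩ := hn s hs r hr
    exact ⟨hv, hne, hall _⟩
  simp only [uniformAvg]
  rw [Finset.sum_congr rfl fun (x : List.Vector Bool n) _ => hone x.toList (by simp)]
  simp [card_vector]

end Summit.QuantumAdvantage.QuantumAdvantage.Cruxes.WbwObfuscatedGluedTrees.KnowledgeOfWalkSplit
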